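import Mathlib
import Literature.Algebra.Polynomial.FischerInnerProduct
import Summits.KontsevichZagierPeriods.KontsevichZagierPeriods.Theorems.InverseLandauTateFamilyKernelStubBoundaryFamily
import Summits.KontsevichZagierPeriods.KontsevichZagierPeriods.Theorems.InverseLandauTateFamilyKernelStubDerivFamily

/-!
# Crux `TateFamilyKernel` (stmt-KontsevichZagierPeriods-9130), line `Sketch` — stub `stub_exactWall`

Wall absorption for family-level Griffiths data. If `c(ϖ) · P/Q = Σ_k ∂_{i_k}(A_k/D_k)` pointwise on
`[0,1]^{N+2} × (0,ε)` with `c ∈ ℚ[ϖ] ∖ 0`, Tate admissible `D_k`, `Q` admissible and `∫ P/Q ≡ 0`, then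
at every real-algebraic `ϖ₀ ∈ (0,ε)` — including the walls `c(ϖ₀) = 0` — the fibre `P/Q(·,ϖ₀)` is
Griffiths-exact with `ℚ`-polynomial data, whose boundary family (`stub_boundaryFamily`) is Tate,
admissible and has identically vanishing integrals on `(0,ε)`.

Proof (the derivative trick). Work with (numerator, denominator) data `p = (U, V)` and the formal
quotient-rule operators `Γ_a p = (∂_a U · V − U · ∂_a V, V²)`; the Griffiths integrand along `a` is the
value of `Γ_a p`, and the `ϖ`-derivative of the value of `p` is the value of `δ p`, `δ = Γ_ϖ`
(`hasDerivAt_aeval_div_aeval_snoc`). KEY ALGEBRA: `Γ_a ∘ δ = δ ∘ Γ_a` literally (commuting partials,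
`Literature.Algebra.Polynomial.pderiv_pderiv_comm`),
so the `μ`-th `ϖ`-derivative of `Σ_k Γ_{a_k} p_k` is `Σ_k Γ_{a_k} (δ^μ p_k)` — again Griffiths data, with
denominators `D_k^{2^μ}` (Tate, admissible). KEY ANALYSIS: with `μ = ord_{ϖ₀} c`, the `μ`-th
`ϖ`-derivative of `c · F` (`F = P/Q`) at `ϖ₀` is `c^{(μ)}(ϖ₀) · F(ϖ₀)` (Leibniz `iteratedDeriv_fun_mul`,
lower derivatives of `c` vanish at `ϖ₀`), and `c^{(μ)}(ϖ₀) ∈ ℚ(ϖ₀)^× = ℚ[ϖ₀]^×` is inverted by a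
polynomial `u(ϖ₀)`. The data `(u · (δ^μ p_k)₁, (δ^μ p_k)₂)` are fed to `stub_boundaryFamily`, whose
vanishing hypothesis is `u(ϖ) · ∫ δ^μ(c P, Q) = 0`: `μ` applications of `stub_derivFamily`.
No named fact, no new definition (the operators are universally quantified hypotheses `hΓ`, `hδ`).
-/

noncomputable section

open MeasureTheory Set MvPolynomial
open Literature.NumberTheory.Transcendental
open Literature.ModelTheory.ExponentialFields (analyticOnNhd_aeval)

namespace Summit.KontsevichZagierPeriods.InverseLandau.TateFamilyKernel.Descent

variable {n : ℕ}

/-- **Key algebra.** The formal quotient-rule operators `Γ_a (U, V) = (∂_a U · V − U · ∂_a V, V²)` in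
two directions commute literally: `Γ_a (Γ_b p) = Γ_b (Γ_a p)` (both numerators are
`V³ ∂_a∂_b U − V² (∂_a U ∂_b V + ∂_b U ∂_a V + U ∂_a∂_b V) + 2 U V ∂_a V ∂_b V`; commuting partials
`Literature.Algebra.Polynomial.pderiv_pderiv_comm`, transported from `ℝ` to `ℚ` coefficients by the
injectivity of `MvPolynomial.map`). [folklore] -/
theorem wall_comm {a b : Fin (n + 1)}
    {Γa Γb : MvPolynomial (Fin (n + 1)) ℚ × MvPolynomial (Fin (n + 1)) ℚ →
      MvPolynomial (Fin (n + 1)) ℚ × MvPolynomial (Fin (n + 1)) ℚ}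
    (ha : ∀ p, Γa p = (pderiv a p.1 * p.2 - p.1 * pderiv a p.2, p.2 ^ 2))
    (hb : ∀ p, Γb p = (pderiv b p.1 * p.2 - p.1 * pderiv b p.2, p.2 ^ 2)) :
    Function.Commute Γa Γb := by
  have hc : ∀ q : MvPolynomial (Fin (n + 1)) ℚ, pderiv a (pderiv b q) = pderiv b (pderiv a q) :=
    fun q => MvPolynomial.map_injective (algebraMap ℚ ℝ) (algebraMap ℚ ℝ).injective (by
      simpa only [pderiv_map] using
        Literature.Algebra.Polynomial.pderiv_pderiv_comm a b (MvPolynomial.map (algebraMap ℚ ℝ) q))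
  intro p
  refine Prod.ext ?_ (by simp only [ha, hb])
  simp only [ha, hb, map_sub, pderiv_mul, pderiv_pow]
  rw [hc p.1, hc p.2]
  ring

/-- The denominator of `j`-fold quotient-rule data is `V ^ 2 ^ j`. [folklore] -/
theorem wall_snd_iterate {a : Fin (n + 1)}
    {T : MvPolynomial (Fin (n + 1)) ℚ × MvPolynomial (Fin (n + 1)) ℚ →
      MvPolynomial (Fin (n + 1)) ℚ × MvPolynomial (Fin (n + 1)) ℚ}
    (hT : ∀ p, T p = (pderiv a p.1 * p.2 - p.1 * pderiv a p.2, p.2 ^ 2))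
    (p : MvPolynomial (Fin (n + 1)) ℚ × MvPolynomial (Fin (n + 1)) ℚ) (j : ℕ) :
    (T^[j] p).2 = p.2 ^ 2 ^ j := by
  induction j with
  | zero => simp
  | succ j ih =>
    rw [Function.iterate_succ_apply', hT]
    dsimp only
    rw [ih, ← pow_mul, pow_succ]

/-- A polynomial in the parameter alone, `u(ϖ)` lifted to `ℚ[w, ϖ]`, evaluates at `(w, x)` to `u(x)`.
[folklore] -/
theorem wall_aeval_scalar (u : Polynomial ℚ) (w : Fin n → ℝ) (x : ℝ) :
    aeval (Fin.snoc w x : Fin (n + 1) → ℝ)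
        (Polynomial.aeval (X (Fin.last n) : MvPolynomial (Fin (n + 1)) ℚ) u) =
      (Polynomial.aeval x u : ℝ) := by
  rw [← Polynomial.aeval_algHom_apply, aeval_X, Fin.snoc_last]

/-- A polynomial in the parameter alone has vanishing partial derivatives along the cube
directions. [folklore] -/
theorem wall_pderiv_scalar (u : Polynomial ℚ) (j : Fin n) :
    pderiv (Fin.castSucc j) (Polynomial.aeval (X (Fin.last n) : MvPolynomial (Fin (n + 1)) ℚ) u) = 0 := by
  induction u using Polynomial.induction_on' with
  | add p q hp hq => rw [map_add, map_add, hp, hq, add_zero]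
  | monomial m r =>
    simp [Polynomial.aeval_monomial, pderiv_X_of_ne (Fin.castSucc_lt_last j).ne']

/-- `ϖ ↦ R(w, ϖ)` is smooth (a polynomial function of the parameter). [folklore] -/
theorem wall_contDiff (R : MvPolynomial (Fin (n + 1)) ℚ) (w : Fin n → ℝ) {m : WithTop ℕ∞} :
    ContDiff ℝ m (fun x : ℝ => aeval (Fin.snoc w x : Fin (n + 1) → ℝ) R) := by
  have hs : ContDiff ℝ m (fun x : ℝ => (Fin.snoc w x : Fin (n + 1) → ℝ)) := by
    refine contDiff_pi.2 fun j => ?_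
    refine Fin.lastCases ?_ (fun t => ?_) j
    · simp only [Fin.snoc_last]
      exact contDiff_id
    · simp only [Fin.snoc_castSucc]
      exact contDiff_const
  exact (analyticOnNhd_aeval R).contDiff.comp hs

/-- **Iterated `ϖ`-derivatives of a rational family are the values of the iterated quotient-rule
data**: on `(0, ε)`, `∂_ϖ^j (U/V)(w, ·) = (δ^j (U, V))₁ / (δ^j (U, V))₂ (w, ·)` whenever
`V(w, ·) ≠ 0` there (`hasDerivAt_aeval_div_aeval_snoc`, locality of `deriv`). [folklore] -/
theorem wall_iteratedDeriv
    {δ : MvPolynomial (Fin (n + 1)) ℚ × MvPolynomial (Fin (n + 1)) ℚ →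
      MvPolynomial (Fin (n + 1)) ℚ × MvPolynomial (Fin (n + 1)) ℚ}
    (hδ : ∀ p, δ p = (pderiv (Fin.last n) p.1 * p.2 - p.1 * pderiv (Fin.last n) p.2, p.2 ^ 2))
    (p : MvPolynomial (Fin (n + 1)) ℚ × MvPolynomial (Fin (n + 1)) ℚ) (w : Fin n → ℝ) {ε : ℝ}
    (hp : ∀ x ∈ Ioo (0 : ℝ) ε, aeval (Fin.snoc w x : Fin (n + 1) → ℝ) p.2 ≠ 0) (j : ℕ) :
    ∀ x ∈ Ioo (0 : ℝ) ε, iteratedDeriv j (fun y : ℝ => aeval (Fin.snoc w y : Fin (n + 1) → ℝ) p.1 /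
        aeval (Fin.snoc w y : Fin (n + 1) → ℝ) p.2) x =
      aeval (Fin.snoc w x : Fin (n + 1) → ℝ) (δ^[j] p).1 /
        aeval (Fin.snoc w x : Fin (n + 1) → ℝ) (δ^[j] p).2 := by
  induction j with
  | zero => intro x _; simp
  | succ j ih =>
    intro x hx
    have hne : aeval (Fin.snoc w x : Fin (n + 1) → ℝ) (δ^[j] p).2 ≠ 0 := by
      rw [wall_snd_iterate hδ, map_pow]
      exact pow_ne_zero _ (hp x hx)
    rw [iteratedDeriv_succ, Function.iterate_succ_apply', hδ,
      (Filter.eventuallyEq_of_mem (Ioo_mem_nhds hx.1 hx.2) ih :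
        iteratedDeriv j _ =ᶠ[nhds x] _).deriv_eq]
    exact (hasDerivAt_aeval_div_aeval_snoc _ _ w x hne).deriv

/-- **Wall absorption for family-level Griffiths data** (stub `stub_exactWall` of the crux
`TateFamilyKernel`, line `Sketch`; uses `stub_derivFamily` and `stub_boundaryFamily`). If the Tate
family `P/Q` (admissible, vanishing on `(0,ε)`) is Griffiths-exact at family level up to a scalar,
`c(ϖ)·P/Q = Σ_k ∂_{i_k}(A_k/D_k)` pointwise on `[0,1]^{N+2} × (0,ε)` with Tate admissible `D_k` and
`c ∈ ℚ[ϖ] ∖ 0`, then at EVERY real-algebraic `ϖ₀ ∈ (0,ε)` — including the walls `c(ϖ₀) = 0` — the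
fibre is Griffiths-exact with `ℚ`-polynomial data evaluated at `ϖ₀`, and the summed face differences
of these data are the fibre at `ϖ₀` of a Tate boundary family, admissible on `(0,ε)`, with
identically vanishing integrals (the hypotheses of `stub_exactDescent`). Proof: with
`μ = ord_{ϖ₀} c`, differentiate the identity `μ` times in `ϖ` (quotient rule as polynomial data,
commuting with the Griffiths numerator, `wall_comm`), evaluate at `ϖ₀` where
`∂^μ(c F)(ϖ₀) = c^{(μ)}(ϖ₀) F(ϖ₀)`, divide by `c^{(μ)}(ϖ₀) ∈ ℚ[ϖ₀]^×` (a polynomial `u` with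
`u(ϖ₀) c^{(μ)}(ϖ₀) = 1`), and feed the data `u · A_k^{(μ)}, D_k^{2^μ}` to `stub_boundaryFamily`, whose
vanishing hypothesis is `μ` applications of `stub_derivFamily` to `c · P/Q`.
[cite: KontsevichZagier2001, §1.2] -/
theorem stub_exactWall (N K : ℕ) (i : Fin K → Fin (N + 2)) (P Q : MvPolynomial (Fin (N + 2 + 1)) ℚ)
    (A Dn : Fin K → MvPolynomial (Fin (N + 2 + 1)) ℚ) (c : Polynomial ℚ) (ε : ℝ) (hε : 0 < ε)
    (hc : c ≠ 0)
    (hTD : ∀ k, ∃ c₀ : ℚ, c₀ ≠ 0 ∧ ∀ w : Fin (N + 2) → ℝ,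
      aeval (Fin.snoc w (0 : ℝ) : Fin (N + 2 + 1) → ℝ) (Dn k) = (c₀ : ℝ))
    (hadmD : ∀ k (w : Fin (N + 2) → ℝ) (ϖ : ℝ), (∀ t, w t ∈ Icc (0 : ℝ) 1) → ϖ ∈ Ioo 0 ε →
      aeval (Fin.snoc w ϖ : Fin (N + 2 + 1) → ℝ) (Dn k) ≠ 0)
    (hadmQ : ∀ (w : Fin (N + 2) → ℝ) (ϖ : ℝ), (∀ t, w t ∈ Icc (0 : ℝ) 1) → ϖ ∈ Ioo 0 ε →
      aeval (Fin.snoc w ϖ : Fin (N + 2 + 1) → ℝ) Q ≠ 0)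
    (hvan : ∀ ϖ ∈ Ioo 0 ε, ∫ w in Set.pi Set.univ (fun _ : Fin (N + 2) => Ioo (0 : ℝ) 1),
      aeval (Fin.snoc w ϖ : Fin (N + 2 + 1) → ℝ) P / aeval (Fin.snoc w ϖ : Fin (N + 2 + 1) → ℝ) Q = 0)
    (hexact : ∀ ϖ ∈ Ioo 0 ε, ∀ w ∈ KZ.cube (N + 2),
      (Polynomial.aeval ϖ c : ℝ) *
          (aeval (Fin.snoc w ϖ : Fin (N + 2 + 1) → ℝ) P / aeval (Fin.snoc w ϖ : Fin (N + 2 + 1) → ℝ) Q) =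
        ∑ k, aeval (Fin.snoc w ϖ : Fin (N + 2 + 1) → ℝ)
            (pderiv (Fin.castSucc (i k)) (A k) * Dn k - A k * pderiv (Fin.castSucc (i k)) (Dn k)) /
          aeval (Fin.snoc w ϖ : Fin (N + 2 + 1) → ℝ) (Dn k ^ 2))
    (ϖ₀ : ℝ) (halg : IsAlgebraic ℚ ϖ₀) (hϖ₀ : ϖ₀ ∈ Ioo 0 ε) :
    ∃ (K' : ℕ) (i' : Fin K' → Fin (N + 2)) (A' Dn' : Fin K' → MvPolynomial (Fin (N + 2 + 1)) ℚ)
      (Pb Qb : MvPolynomial (Fin (N + 1 + 1)) ℚ),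
      (∀ k, ∀ w ∈ KZ.cube (N + 2), aeval (Fin.snoc w ϖ₀ : Fin (N + 2 + 1) → ℝ) (Dn' k) ≠ 0) ∧
      (∃ c₀ : ℚ, c₀ ≠ 0 ∧ ∀ x : Fin (N + 1) → ℝ,
        aeval (Fin.snoc x (0 : ℝ) : Fin (N + 1 + 1) → ℝ) Qb = (c₀ : ℝ)) ∧
      (∀ (x : Fin (N + 1) → ℝ) (ϖ : ℝ), (∀ t, x t ∈ Icc (0 : ℝ) 1) → ϖ ∈ Ioo 0 ε →
        aeval (Fin.snoc x ϖ : Fin (N + 1 + 1) → ℝ) Qb ≠ 0) ∧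
      (∀ x ∈ KZ.cube (N + 1),
        aeval (Fin.snoc x ϖ₀ : Fin (N + 1 + 1) → ℝ) Pb / aeval (Fin.snoc x ϖ₀ : Fin (N + 1 + 1) → ℝ) Qb =
          ∑ k, (aeval (Fin.snoc (Fin.insertNth (i' k) 1 x) ϖ₀ : Fin (N + 2 + 1) → ℝ) (A' k) /
                aeval (Fin.snoc (Fin.insertNth (i' k) 1 x) ϖ₀ : Fin (N + 2 + 1) → ℝ) (Dn' k) -
              aeval (Fin.snoc (Fin.insertNth (i' k) 0 x) ϖ₀ : Fin (N + 2 + 1) → ℝ) (A' k) /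
                aeval (Fin.snoc (Fin.insertNth (i' k) 0 x) ϖ₀ : Fin (N + 2 + 1) → ℝ) (Dn' k))) ∧
      (∀ ϖ ∈ Ioo (0 : ℝ) ε, ∫ x in Set.pi Set.univ (fun _ : Fin (N + 1) => Ioo (0 : ℝ) 1),
        aeval (Fin.snoc x ϖ : Fin (N + 1 + 1) → ℝ) Pb / aeval (Fin.snoc x ϖ : Fin (N + 1 + 1) → ℝ) Qb = 0) ∧
      (∀ w ∈ KZ.cube (N + 2),
        aeval (Fin.snoc w ϖ₀ : Fin (N + 2 + 1) → ℝ) P / aeval (Fin.snoc w ϖ₀ : Fin (N + 2 + 1) → ℝ) Q =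
          ∑ k, aeval (Fin.snoc w ϖ₀ : Fin (N + 2 + 1) → ℝ)
              (pderiv (Fin.castSucc (i' k)) (A' k) * Dn' k - A' k * pderiv (Fin.castSucc (i' k)) (Dn' k)) /
            aeval (Fin.snoc w ϖ₀ : Fin (N + 2 + 1) → ℝ) (Dn' k ^ 2)) := by
  classical
  /- Step 0: the formal quotient-rule operators `Γ k` (direction `i k`) and `δ` (direction `ϖ`). -/
  obtain ⟨Γ, hΓ⟩ : ∃ Γ : Fin K → MvPolynomial (Fin (N + 2 + 1)) ℚ × MvPolynomial (Fin (N + 2 + 1)) ℚ →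
      MvPolynomial (Fin (N + 2 + 1)) ℚ × MvPolynomial (Fin (N + 2 + 1)) ℚ, ∀ k p, Γ k p =
      (pderiv (Fin.castSucc (i k)) p.1 * p.2 - p.1 * pderiv (Fin.castSucc (i k)) p.2, p.2 ^ 2) :=
    ⟨_, fun _ _ => rfl⟩
  obtain ⟨δ, hδ⟩ : ∃ δ : MvPolynomial (Fin (N + 2 + 1)) ℚ × MvPolynomial (Fin (N + 2 + 1)) ℚ →
      MvPolynomial (Fin (N + 2 + 1)) ℚ × MvPolynomial (Fin (N + 2 + 1)) ℚ, ∀ p, δ p =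
      (pderiv (Fin.last (N + 2)) p.1 * p.2 - p.1 * pderiv (Fin.last (N + 2)) p.2, p.2 ^ 2) :=
    ⟨_, fun _ => rfl⟩
  /- Step 1: the wall order `μ` and the leading coefficient `κ = c^{(μ)}(ϖ₀) ≠ 0`. -/
  set cR : Polynomial ℝ := c.map (algebraMap ℚ ℝ) with hcR
  have hcR0 : cR ≠ 0 := (Polynomial.map_ne_zero_iff (algebraMap ℚ ℝ).injective).2 hc
  set μ : ℕ := cR.rootMultiplicity ϖ₀ with hμ
  have hder : ∀ l, (Polynomial.derivative^[l] cR).eval ϖ₀ =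
      (Polynomial.aeval ϖ₀ (Polynomial.derivative^[l] c) : ℝ) := fun l => by
    rw [hcR, Polynomial.iterate_derivative_map, Polynomial.eval_map_algebraMap]
  have hroot : ∀ l < μ, (Polynomial.aeval ϖ₀ (Polynomial.derivative^[l] c) : ℝ) = 0 := fun l hl => by
    rw [← hder]
    exact Polynomial.isRoot_iterate_derivative_of_lt_rootMultiplicity hl
  have hκ : (Polynomial.aeval ϖ₀ (Polynomial.derivative^[μ] c) : ℝ) ≠ 0 := by
    rw [← hder, hμ, Polynomial.eval_iterate_derivative_rootMultiplicity, nsmul_eq_mul]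
    exact mul_ne_zero (Nat.cast_ne_zero.2 (Nat.factorial_ne_zero _))
      (Polynomial.eval_divByMonic_pow_rootMultiplicity_ne_zero ϖ₀ hcR0)
  /- Step 2: `κ⁻¹ = u(ϖ₀)` for a polynomial `u ∈ ℚ[X]` (`ℚ[ϖ₀]` is a field). -/
  obtain ⟨u, hu⟩ : ∃ u : Polynomial ℚ, (Polynomial.aeval ϖ₀ u : ℝ) =
      (Polynomial.aeval ϖ₀ (Polynomial.derivative^[μ] c) : ℝ)⁻¹ := by
    have hrg : ∀ y : ℝ, y ∈ (Polynomial.aeval ϖ₀ : Polynomial ℚ →ₐ[ℚ] ℝ).range ↔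
        y ∈ IntermediateField.adjoin ℚ {ϖ₀} := fun y => by
      rw [← Algebra.adjoin_singleton_eq_range_aeval,
        ← IntermediateField.adjoin_simple_toSubalgebra_of_isAlgebraic halg,
        IntermediateField.mem_toSubalgebra]
    exact (AlgHom.mem_range _).1 ((hrg _).2 (IntermediateField.inv_mem _ ((hrg _).1 ⟨_, rfl⟩)))
  /- Step 3: iterated derivatives of the scalar. -/
  have hcf : ∀ l, iteratedDeriv l (fun x : ℝ => (Polynomial.aeval x c : ℝ)) =
      fun x => (Polynomial.aeval x (Polynomial.derivative^[l] c) : ℝ) := by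
    intro l
    induction l with
    | zero => simp
    | succ l ih =>
      rw [iteratedDeriv_succ, ih]
      funext x
      rw [Function.iterate_succ_apply']
      exact ((Polynomial.derivative^[l] c).hasDerivAt_aeval x).deriv
  /- Step 4 (★): on `(0,ε) × cube`, `∂_ϖ^μ (c F)(w, ϖ) = Σ_k value of δ^μ (Γ_k p_k)`. -/
  have hstar : ∀ ϖ ∈ Ioo (0 : ℝ) ε, ∀ w ∈ KZ.cube (N + 2),
      iteratedDeriv μ (fun x : ℝ => (Polynomial.aeval x c : ℝ) *
        (aeval (Fin.snoc w x : Fin (N + 2 + 1) → ℝ) P / aeval (Fin.snoc w x : Fin (N + 2 + 1) → ℝ) Q)) ϖ =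
      ∑ k, aeval (Fin.snoc w ϖ : Fin (N + 2 + 1) → ℝ) (δ^[μ] (Γ k (A k, Dn k))).1 /
        aeval (Fin.snoc w ϖ : Fin (N + 2 + 1) → ℝ) (δ^[μ] (Γ k (A k, Dn k))).2 := by
    intro ϖ hϖ w hw
    have hD : ∀ k, ∀ x ∈ Ioo (0 : ℝ) ε,
        aeval (Fin.snoc w x : Fin (N + 2 + 1) → ℝ) (Γ k (A k, Dn k)).2 ≠ 0 := fun k x hx => by
      simp only [hΓ, map_pow]
      exact pow_ne_zero 2 (hadmD k w x (fun t => hw t) hx)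
    have heq : (fun x : ℝ => (Polynomial.aeval x c : ℝ) *
        (aeval (Fin.snoc w x : Fin (N + 2 + 1) → ℝ) P / aeval (Fin.snoc w x : Fin (N + 2 + 1) → ℝ) Q))
        =ᶠ[nhds ϖ] fun x => ∑ k, aeval (Fin.snoc w x : Fin (N + 2 + 1) → ℝ) (Γ k (A k, Dn k)).1 /
          aeval (Fin.snoc w x : Fin (N + 2 + 1) → ℝ) (Γ k (A k, Dn k)).2 := by
      filter_upwards [Ioo_mem_nhds hϖ.1 hϖ.2] with x hx
      rw [hexact x hx w hw]
      simp only [hΓ]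
    rw [heq.iteratedDeriv_eq μ, iteratedDeriv_fun_sum fun k _ =>
      (wall_contDiff _ w).contDiffAt.fun_div (wall_contDiff _ w).contDiffAt (hD k ϖ hϖ)]
    exact Finset.sum_congr rfl fun k _ => wall_iteratedDeriv hδ _ w (hD k) μ ϖ hϖ
  /- Step 5: at the wall, `∂_ϖ^μ (c F)(w, ϖ₀) = κ F(w, ϖ₀)` (Leibniz; lower derivatives of `c` vanish). -/
  have hlead : ∀ w ∈ KZ.cube (N + 2),
      iteratedDeriv μ (fun x : ℝ => (Polynomial.aeval x c : ℝ) *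
        (aeval (Fin.snoc w x : Fin (N + 2 + 1) → ℝ) P / aeval (Fin.snoc w x : Fin (N + 2 + 1) → ℝ) Q)) ϖ₀ =
      (Polynomial.aeval ϖ₀ (Polynomial.derivative^[μ] c) : ℝ) *
        (aeval (Fin.snoc w ϖ₀ : Fin (N + 2 + 1) → ℝ) P / aeval (Fin.snoc w ϖ₀ : Fin (N + 2 + 1) → ℝ) Q) := by
    intro w hw
    have hQ0 : aeval (Fin.snoc w ϖ₀ : Fin (N + 2 + 1) → ℝ) Q ≠ 0 := hadmQ w ϖ₀ (fun t => hw t) hϖ₀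
    rw [iteratedDeriv_fun_mul (Polynomial.contDiff_aeval (𝕜 := ℝ) c _).contDiffAt
        ((wall_contDiff P w).contDiffAt.fun_div (wall_contDiff Q w).contDiffAt hQ0),
      Finset.sum_range_succ, Finset.sum_eq_zero, zero_add, Nat.choose_self, Nat.cast_one, one_mul,
      Nat.sub_self, iteratedDeriv_zero, hcf]
    intro l hl
    simp only [hcf, hroot l (Finset.mem_range.1 hl), mul_zero, zero_mul]
  /- Step 6: the new data `A' k = ũ · (δ^μ p_k)₁`, `Dn' k = (δ^μ p_k)₂ = D_k^{2^μ}`. -/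
  obtain ⟨ũ, hũ⟩ : ∃ ũ : MvPolynomial (Fin (N + 2 + 1)) ℚ,
      ũ = Polynomial.aeval (X (Fin.last (N + 2))) u := ⟨_, rfl⟩
  obtain ⟨d, hd⟩ : ∃ d : Fin K → MvPolynomial (Fin (N + 2 + 1)) ℚ × MvPolynomial (Fin (N + 2 + 1)) ℚ,
      ∀ k, d k = δ^[μ] (A k, Dn k) := ⟨_, fun _ => rfl⟩
  have hG : ∀ k (w : Fin (N + 2) → ℝ) (x : ℝ),
      aeval (Fin.snoc w x : Fin (N + 2 + 1) → ℝ) (pderiv (Fin.castSucc (i k)) (ũ * (d k).1) * (d k).2 -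
          ũ * (d k).1 * pderiv (Fin.castSucc (i k)) (d k).2) /
        aeval (Fin.snoc w x : Fin (N + 2 + 1) → ℝ) ((d k).2 ^ 2) =
      (Polynomial.aeval x u : ℝ) * (aeval (Fin.snoc w x : Fin (N + 2 + 1) → ℝ) (δ^[μ] (Γ k (A k, Dn k))).1 /
        aeval (Fin.snoc w x : Fin (N + 2 + 1) → ℝ) (δ^[μ] (Γ k (A k, Dn k))).2) := by
    intro k w x
    have hpol : pderiv (Fin.castSucc (i k)) (ũ * (d k).1) * (d k).2 -
        ũ * (d k).1 * pderiv (Fin.castSucc (i k)) (d k).2 =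
        ũ * (pderiv (Fin.castSucc (i k)) (d k).1 * (d k).2 - (d k).1 * pderiv (Fin.castSucc (i k)) (d k).2) := by
      rw [pderiv_mul, hũ, wall_pderiv_scalar, zero_mul, zero_add]
      ring
    rw [hpol, map_mul, hũ, wall_aeval_scalar, mul_div_assoc,
      ← ((wall_comm (hΓ k) hδ).iterate_right μ).eq (A k, Dn k), ← hd, hΓ]
  have hadm' : ∀ k (w : Fin (N + 2) → ℝ) (ϖ : ℝ), (∀ t, w t ∈ Icc (0 : ℝ) 1) → ϖ ∈ Ioo 0 ε →
      aeval (Fin.snoc w ϖ : Fin (N + 2 + 1) → ℝ) (d k).2 ≠ 0 := fun k w ϖ hw hϖ => by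
    simp only [hd, wall_snd_iterate hδ, map_pow]
    exact pow_ne_zero _ (hadmD k w ϖ hw hϖ)
  have hT' : ∀ k, ∃ c₀ : ℚ, c₀ ≠ 0 ∧ ∀ w : Fin (N + 2) → ℝ,
      aeval (Fin.snoc w (0 : ℝ) : Fin (N + 2 + 1) → ℝ) (d k).2 = (c₀ : ℝ) := fun k => by
    obtain ⟨c₀, hc₀, hc₀w⟩ := hTD k
    refine ⟨c₀ ^ 2 ^ μ, pow_ne_zero _ hc₀, fun w => ?_⟩
    simp only [hd, wall_snd_iterate hδ, map_pow, hc₀w, Rat.cast_pow]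
  /- Step 7: `∫ δ^j (c P, Q) ≡ 0` on `(0,ε)` for every `j` (`stub_derivFamily`, iterated). -/
  have hcP : ∀ (w : Fin (N + 2) → ℝ) (x : ℝ), aeval (Fin.snoc w x : Fin (N + 2 + 1) → ℝ)
      (Polynomial.aeval (X (Fin.last (N + 2))) c * P) = (Polynomial.aeval x c : ℝ) *
        aeval (Fin.snoc w x : Fin (N + 2 + 1) → ℝ) P := fun w x => by
    rw [map_mul, wall_aeval_scalar]
  have hint : ∀ j, ∀ ϖ ∈ Ioo (0 : ℝ) ε, ∫ z in Set.pi Set.univ (fun _ : Fin (N + 2) => Ioo (0 : ℝ) 1),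
      aeval (Fin.snoc z ϖ : Fin (N + 2 + 1) → ℝ) (δ^[j] (Polynomial.aeval (X (Fin.last (N + 2))) c * P, Q)).1 /
        aeval (Fin.snoc z ϖ : Fin (N + 2 + 1) → ℝ) (δ^[j] (Polynomial.aeval (X (Fin.last (N + 2))) c * P, Q)).2
        = 0 := by
    intro j
    induction j with
    | zero =>
      intro ϖ hϖ
      simp only [Function.iterate_zero, id_eq, hcP, mul_div_assoc]
      rw [integral_const_mul, hvan ϖ hϖ, mul_zero]
    | succ j ih =>
      intro ϖ hϖ
      rw [Function.iterate_succ_apply', hδ]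
      exact stub_derivFamily (N + 2) _ _ ε (fun z x hz hx => by
        rw [wall_snd_iterate hδ, map_pow]; exact pow_ne_zero _ (hadmQ z x hz hx)) ih ϖ hϖ
  /- Step 8: the boundary family of the new data. -/
  have hsum : ∀ ϖ ∈ Ioo (0 : ℝ) ε, ∀ w ∈ KZ.cube (N + 2),
      ∑ k, aeval (Fin.snoc w ϖ : Fin (N + 2 + 1) → ℝ) (pderiv (Fin.castSucc (i k)) (ũ * (d k).1) * (d k).2 -
          ũ * (d k).1 * pderiv (Fin.castSucc (i k)) (d k).2) /
        aeval (Fin.snoc w ϖ : Fin (N + 2 + 1) → ℝ) ((d k).2 ^ 2) =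
      (Polynomial.aeval ϖ u : ℝ) * iteratedDeriv μ (fun x : ℝ => (Polynomial.aeval x c : ℝ) *
        (aeval (Fin.snoc w x : Fin (N + 2 + 1) → ℝ) P / aeval (Fin.snoc w x : Fin (N + 2 + 1) → ℝ) Q)) ϖ :=
    fun ϖ hϖ w hw => by
      rw [Finset.sum_congr rfl fun k _ => hG k w ϖ, ← Finset.mul_sum, hstar ϖ hϖ w hw]
  have hvan' : ∀ ϖ ∈ Ioo (0 : ℝ) ε, ∫ w in KZ.cube (N + 2),
      ∑ k, aeval (Fin.snoc w ϖ : Fin (N + 2 + 1) → ℝ) (pderiv (Fin.castSucc (i k)) (ũ * (d k).1) * (d k).2 -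
          ũ * (d k).1 * pderiv (Fin.castSucc (i k)) (d k).2) /
        aeval (Fin.snoc w ϖ : Fin (N + 2 + 1) → ℝ) ((d k).2 ^ 2) = 0 := by
    intro ϖ hϖ
    have hpt : ∀ w ∈ KZ.cube (N + 2),
        ∑ k, aeval (Fin.snoc w ϖ : Fin (N + 2 + 1) → ℝ) (pderiv (Fin.castSucc (i k)) (ũ * (d k).1) * (d k).2 -
            ũ * (d k).1 * pderiv (Fin.castSucc (i k)) (d k).2) /
          aeval (Fin.snoc w ϖ : Fin (N + 2 + 1) → ℝ) ((d k).2 ^ 2) =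
        (Polynomial.aeval ϖ u : ℝ) *
          (aeval (Fin.snoc w ϖ : Fin (N + 2 + 1) → ℝ)
              (δ^[μ] (Polynomial.aeval (X (Fin.last (N + 2))) c * P, Q)).1 /
            aeval (Fin.snoc w ϖ : Fin (N + 2 + 1) → ℝ)
              (δ^[μ] (Polynomial.aeval (X (Fin.last (N + 2))) c * P, Q)).2) := by
      intro w hw
      rw [hsum ϖ hϖ w hw, ← wall_iteratedDeriv hδ _ w (fun x hx => hadmQ w x (fun t => hw t) hx) μ ϖ hϖ]
      simp only [hcP, mul_div_assoc]
    rw [setIntegral_congr_fun KZ.measurableSet_cube hpt, integral_const_mul,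
      ← setIntegral_pi_Ioo_eq_setIntegral_cube', hint μ ϖ hϖ, mul_zero]
  obtain ⟨Pb, Qb, hbT, hbadm, hbval, hbvan⟩ :=
    stub_boundaryFamily N K i (fun k => ũ * (d k).1) (fun k => (d k).2) ε hε hT' hadm' hvan'
  refine ⟨K, i, fun k => ũ * (d k).1, fun k => (d k).2, Pb, Qb,
    fun k w hw => hadm' k w ϖ₀ (fun t => hw t) hϖ₀, hbT, hbadm, hbval ϖ₀ hϖ₀, hbvan, fun w hw => ?_⟩
  rw [hsum ϖ₀ hϖ₀ w hw, hlead w hw, ← mul_assoc, hu, inv_mul_cancel₀ hκ, one_mul]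

end Summit.KontsevichZagierPeriods.InverseLandau.TateFamilyKernel.Descent

end
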